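import Literature.NumberTheory.Automorphic.SatakeParametersModP
import Literature.NumberTheory.Automorphic.SymmLaurentWeylInvariants
import Mathlib.RingTheory.MvPolynomial.Symmetric.FundamentalTheorem
import HarnessLib

/-!
# The Satake isomorphism with coefficients in any commutative ring in which `q` is a unit:
# `𝒮_R : ℋ_R(GL_n(F), GL_n(𝒪)) ≅ R[ℤⁿ]^{S_n}` (Treumann–Venkatesh §7.2 Thm. (i); Cartier Thm. 4.1; Gross §3)

Topic `NumberTheory/Automorphic`; namespace `Literature.NumberTheory.Automorphic` (lane `lit-hodgefound`, Track 2
foundations; seat `lit-hodgefound-p11`, generation 42, row g42-#6).  THEOREMS ONLY: no definition, no named fact, no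
instance, no notation.  Closes the item recorded under "Not in this file" in the module docstring of the tree's
`SatakeTransformModP`: «The **Satake isomorphism over `R`** — `𝒮_R` is an isomorphism of `ℋ_R(G, K)` onto the
`S_n`-invariants `R[ℤⁿ]^{S_n} = weylInvariants R (Fin n → ℤ) (glWeylGroup n)` whenever `q ∈ Rˣ` […] With the present
names it reads `Function.Bijective ((satakeTransformModP hϖ hq).codRestrict (weylInvariants R (Fin n → ℤ)
(ConnectedReductiveGroupData.glWeylGroup n)) h)`» — proved here verbatim (`bijective_codRestrict_satakeTransformModP`),
for every field `F` with a `ValuativeRel` whose valuation ring is a DVR with finite residue field (any characteristic, no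
completeness) and EVERY commutative ring `R` with `q ∈ Rˣ`.  Injectivity is g42-#5 `satakeTransformModP_injective`
(Bruhat–Tits (4.4.4)(ii) leading terms, g42-#1); the image is computed from the integral generators of g42-#3
(`ℋ_R = R[T_1, …, T_n, T_n⁻¹]`), Tamagawa's `𝒮_R(T_r) = q^{-r(r-1)/2} e_r(x)` (`SatakeTransformModP`) and the fundamental
theorem of symmetric polynomials over `R` (Mathlib's `MvPolynomial.esymmAlgHom_fin_bijective`) transported to Laurent
polynomials by clearing the denominator `e_n = x_1 ⋯ x_n` (as in the tree's `SymmLaurentWeylInvariants` over `ℂ`, whose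
exponent map `SymmLaurent.expCast` is reused).

## The print

[TreumannVenkatesh2016] §7.2, Theorem, (i): the Satake transform identifies `ℋ(G, K)` with coefficients in `k` with the
`W`-invariants of `k[X_*(A)]` (there for the square-root-free `𝒮*` and the `q`-twisted `W`-action; after the twist by
`q^{-⟨ν, ·⟩}`, which requires `q ∈ Rˣ`, the usual action); [CartierCorvallis1979] §IV Thm. 4.1 «The Satake transformation
is an isomorphism of `H(G, K)` onto `ℂ[X_*(A)]^W`» and §IV.2 Example (`GL_n`: symmetric Laurent polynomials);
[GrossSatake1998] §3 (the isomorphism is defined over `ℤ[q^{±1/2}]`, over `ℤ[q⁻¹]` after twisting); [Macdonald1995]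
Ch. V (2.7) remark «`L(G, K) ≅ ℂ[x_1^{±1}, …, x_n^{±1}]^{S_n}`».

## What is formalised (theorems only)

* §1 Laurent polynomials over `R` (port of `SymmLaurentWeylInvariants` §§1–2 from `ℂ` to `R`, the embedding being the
  term `AddMonoidAlgebra.mapDomainAlgHom R R (SymmLaurent.expCast n) : R[x_1, …, x_n] → R[ℤⁿ]`):
  `mapDomainAlgHom_expCast_monomial/injective/rename`, `exists_mapDomainAlgHom_expCast_eq` (non-negative exponents ⇒ a
  polynomial), `domCongr_eq_self_iff_coeff`, `mem_weylInvariants_glWeylGroup_iff`, `single_const_mem_weylInvariants_glWeylGroup`,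
  `mapDomainAlgHom_expCast_mem_weylInvariants` / `isSymmetric_of_mapDomainAlgHom_expCast_mem_weylInvariants` (a polynomial
  is symmetric iff its Laurent image is `S_n`-invariant), `mapDomainAlgHom_expCast_esymm` (`e_r ↦ ∑_{#t=r} x^{𝟙_t}`),
  `sum_single_indicator_mem_weylInvariants`, `exists_neg_natCast_le_of_mem_support`,
  `forall_nonneg_of_mem_support_single_mul` (clearing denominators).
* §2 the transform on the generators: `satakeTransformModP_doubleCosetOperator_zpowDiagGL_indicator_le`
  (`𝒮_R(c_{(1^{r+1})}) = q^{-r(r+1)/2} e_{r+1}(x)`), `satakeTransformModP_doubleCosetOperator_zpowDiagGL_one`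
  (`𝒮_R(T_{ϖ 1_n}) = q^{-n(n-1)/2} x^{𝟙}`), `satakeTransformModP_doubleCosetOperator_zpowDiagGL_neg_one`
  (`𝒮_R(T_{ϖ⁻¹ 1_n}) = q^{n(n-1)/2} x^{-𝟙}`).
* §3 **`satakeTransformModP_mem_weylInvariants`** (the image is `S_n`-invariant),
  **`mem_range_satakeTransformModP_of_mem_weylInvariants`** (every invariant is a transform),
  **`range_satakeTransformModP_eq_weylInvariants`**, **`bijective_codRestrict_satakeTransformModP`** (THE SATAKE
  ISOMORPHISM OVER `R`, verbatim as recorded in `SatakeTransformModP`), `exists_algEquiv_satakeTransformModP_weylInvariants`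
  (`ℋ_R ≃ₐ[R] R[ℤⁿ]^{S_n}` lifting `𝒮_R`).

## References
* [TreumannVenkatesh2016] D. Treumann, A. Venkatesh, *Functoriality, Smith theory, and the Brauer homomorphism*,
  Ann. of Math. 183 (2016), §7.2 Theorem (i).
* [CartierCorvallis1979] P. Cartier, *Representations of 𝔭-adic groups: a survey*, PSPM 33.1 (1979), §IV Thm. 4.1, §IV.2.
* [GrossSatake1998] B. H. Gross, *On the Satake isomorphism* (1998), §3.
* [Macdonald1995] I. G. Macdonald, *Symmetric Functions and Hall Polynomials*, 2nd ed. (1995), Ch. V (2.7) (PDF p. 247).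
-/

noncomputable section

open scoped MatrixGroups Pointwise
open ValuativeRel Matrix Finset MonoidAlgebra Representation MulAction

namespace Literature.NumberTheory.Automorphic

/-! ## §1 Laurent polynomials over `R`: the embedding of `R[x_1, …, x_n]`, `S_n`-invariants, elementary symmetric functions -/

section Laurent

variable {n : ℕ} {R : Type*} [CommRing R]

/-- The embedding `R[x] → R[ℤⁿ]` is `mapDomain` along `expCast`. [cite: CartierCorvallis1979, §IV.2 Example] -/
theorem mapDomainAlgHom_expCast_apply (p : MvPolynomial (Fin n) R) :
    AddMonoidAlgebra.mapDomainAlgHom R R (SymmLaurent.expCast n) p =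
      AddMonoidAlgebra.mapDomain (SymmLaurent.expCast n) p := rfl

/-- The embedding on monomials: `x^d ↦ [d]`. [cite: CartierCorvallis1979, §IV.2 Example] -/
theorem mapDomainAlgHom_expCast_monomial (d : Fin n →₀ ℕ) (c : R) :
    AddMonoidAlgebra.mapDomainAlgHom R R (SymmLaurent.expCast n) (MvPolynomial.monomial d c) =
      AddMonoidAlgebra.single (SymmLaurent.expCast n d) c := by
  rw [mapDomainAlgHom_expCast_apply, ← MvPolynomial.single_eq_monomial, AddMonoidAlgebra.mapDomain_single]

/-- The embedding `R[x] → R[ℤⁿ]` is injective. [cite: CartierCorvallis1979, §IV.2 Example] -/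
theorem mapDomainAlgHom_expCast_injective :
    Function.Injective (fun p : MvPolynomial (Fin n) R => AddMonoidAlgebra.mapDomainAlgHom R R (SymmLaurent.expCast n) p) :=
  AddMonoidAlgebra.mapDomain_injective (SymmLaurent.expCast_injective n)

/-- A Laurent polynomial over `R` with non-negative exponents is a polynomial. [cite: CartierCorvallis1979, §IV.2 Example] -/
theorem exists_mapDomainAlgHom_expCast_eq {f : AddMonoidAlgebra R (Fin n → ℤ)} (hf : ∀ x ∈ f.coeff.support, 0 ≤ x) :
    ∃ p : MvPolynomial (Fin n) R, AddMonoidAlgebra.mapDomainAlgHom R R (SymmLaurent.expCast n) p = f :=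
  ⟨AddMonoidAlgebra.comapDomain (SymmLaurent.expCast n) (SymmLaurent.expCast_injective n) f,
    AddMonoidAlgebra.mapDomain_comapDomain
      (fun x hx => SymmLaurent.mem_range_expCast n (hf x (by simpa using hx))) _⟩

/-- **Equivariance**: renaming the variables by `σ` is the domain congruence along `x ↦ x ∘ σ⁻¹` of `R[ℤⁿ]`.
[cite: CartierCorvallis1979, §IV.2 Example] -/
theorem mapDomainAlgHom_expCast_rename (σ : Equiv.Perm (Fin n)) (p : MvPolynomial (Fin n) R) :
    AddMonoidAlgebra.mapDomainAlgHom R R (SymmLaurent.expCast n) (MvPolynomial.rename σ p) =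
      AddMonoidAlgebra.domCongr R R (LinearEquiv.funCongrLeft ℤ ℤ σ.symm).toAddEquiv
        (AddMonoidAlgebra.mapDomainAlgHom R R (SymmLaurent.expCast n) p) := by
  refine MvPolynomial.induction_on' p (fun d c => ?_) (fun p q hp hq => ?_)
  · rw [MvPolynomial.rename_monomial, mapDomainAlgHom_expCast_monomial, mapDomainAlgHom_expCast_monomial,
      AddMonoidAlgebra.domCongr_single, SymmLaurent.funCongrLeft_toAddEquiv_apply, SymmLaurent.expCast_mapDomain_perm]
  · simp only [map_add, hp, hq]

/-- The image of a symmetric polynomial is invariant under the coordinate permutations. [cite: CartierCorvallis1979, §IV.2 Example] -/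
theorem domCongr_mapDomainAlgHom_expCast_of_isSymmetric {p : MvPolynomial (Fin n) R} (hp : p.IsSymmetric)
    (σ : Equiv.Perm (Fin n)) :
    AddMonoidAlgebra.domCongr R R (LinearEquiv.funCongrLeft ℤ ℤ σ).toAddEquiv
        (AddMonoidAlgebra.mapDomainAlgHom R R (SymmLaurent.expCast n) p) =
      AddMonoidAlgebra.mapDomainAlgHom R R (SymmLaurent.expCast n) p := by
  have h := mapDomainAlgHom_expCast_rename σ.symm p
  rw [hp σ.symm, Equiv.symm_symm] at h
  exact h.symm

/-- `domCongr e f = f` iff the coefficients of `f` are `e`-invariant. [folklore] [cite: CartierCorvallis1979, §IV.2] -/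
theorem domCongr_eq_self_iff_coeff {X : Type*} [AddCommMonoid X] (e : X ≃+ X) (f : AddMonoidAlgebra R X) :
    AddMonoidAlgebra.domCongr R R e f = f ↔ ∀ x, f.coeff (e x) = f.coeff x := by
  constructor
  · intro h x
    have hx := congrArg (fun g : AddMonoidAlgebra R X => g.coeff (e x)) h
    simp only [AddMonoidAlgebra.coeff_domCongr, AddEquiv.symm_apply_apply] at hx
    exact hx.symm
  · intro h
    ext y
    rw [AddMonoidAlgebra.coeff_domCongr]
    simpa using (h (e.symm y)).symm

/-- **Membership in `R[ℤⁿ]^{S_n}`** (`weylInvariants` for `glWeylGroup n`, the subgroup of `Aut(ℤⁿ)` generated by the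
coordinate permutations) is invariance under every coordinate permutation; the tree's `SymmLaurent.mem_weylInvariants_gl_iff`
is the case `R = ℂ`. [cite: CartierCorvallis1979, §IV.2 Example] -/
theorem mem_weylInvariants_glWeylGroup_iff (f : AddMonoidAlgebra R (Fin n → ℤ)) :
    f ∈ weylInvariants R (Fin n → ℤ) (ConnectedReductiveGroupData.glWeylGroup n) ↔
      ∀ σ : Equiv.Perm (Fin n), AddMonoidAlgebra.domCongr R R (LinearEquiv.funCongrLeft ℤ ℤ σ).toAddEquiv f = f := by
  rw [mem_weylInvariants_iff]
  constructor
  · intro h σ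
    exact h _ (Subgroup.subset_closure ⟨σ, rfl⟩)
  · intro h w hw
    unfold ConnectedReductiveGroupData.glWeylGroup at hw
    induction hw using Subgroup.closure_induction with
    | mem w hw =>
      obtain ⟨σ, rfl⟩ := hw
      exact h σ
    | one =>
      rw [domCongr_eq_self_iff_coeff]
      intro x
      rfl
    | mul a b _ _ ha hb =>
      rw [domCongr_eq_self_iff_coeff] at ha hb ⊢
      intro x
      exact (ha (b x)).trans (hb x)
    | inv a _ ha =>
      rw [domCongr_eq_self_iff_coeff] at ha ⊢
      intro x
      have hx := ha (a.symm x)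
      change f.coeff (a (a.symm x)) = f.coeff (a.symm x) at hx
      rw [LinearEquiv.apply_symm_apply] at hx
      change f.coeff (a⁻¹ x) = f.coeff x
      rw [LinearEquiv.coe_inv]
      exact hx.symm

/-- The monomial `[c𝟙]` of a constant exponent vector is `S_n`-invariant. [cite: CartierCorvallis1979, §IV.2 Example] -/
theorem single_const_mem_weylInvariants_glWeylGroup (c : ℤ) (a : R) :
    AddMonoidAlgebra.single (fun _ : Fin n => c) a ∈
      weylInvariants R (Fin n → ℤ) (ConnectedReductiveGroupData.glWeylGroup n) := by
  rw [mem_weylInvariants_glWeylGroup_iff]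
  intro σ
  rw [AddMonoidAlgebra.domCongr_single]
  rfl

/-- The Laurent image of a symmetric polynomial lies in `R[ℤⁿ]^{S_n}`. [cite: CartierCorvallis1979, §IV.2 Example] -/
theorem mapDomainAlgHom_expCast_mem_weylInvariants {p : MvPolynomial (Fin n) R} (hp : p.IsSymmetric) :
    AddMonoidAlgebra.mapDomainAlgHom R R (SymmLaurent.expCast n) p ∈
      weylInvariants R (Fin n → ℤ) (ConnectedReductiveGroupData.glWeylGroup n) := by
  rw [mem_weylInvariants_glWeylGroup_iff]
  exact fun σ => domCongr_mapDomainAlgHom_expCast_of_isSymmetric hp σ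

/-- Conversely a polynomial whose Laurent image is `S_n`-invariant is symmetric (injectivity + equivariance).
[cite: CartierCorvallis1979, §IV.2 Example] -/
theorem isSymmetric_of_mapDomainAlgHom_expCast_mem_weylInvariants {p : MvPolynomial (Fin n) R}
    (h : AddMonoidAlgebra.mapDomainAlgHom R R (SymmLaurent.expCast n) p ∈
      weylInvariants R (Fin n → ℤ) (ConnectedReductiveGroupData.glWeylGroup n)) : p.IsSymmetric := by
  intro σ
  apply mapDomainAlgHom_expCast_injective (n := n) (R := R)
  simp only
  rw [mapDomainAlgHom_expCast_rename, (mem_weylInvariants_glWeylGroup_iff _).1 h σ.symm]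

/-- `expCast (∑_{i ∈ t} δ_i) = 𝟙_t`. [folklore] [cite: CartierCorvallis1979, §IV.2 Example] -/
theorem expCast_sum_single_eq_indicator (t : Finset (Fin n)) :
    SymmLaurent.expCast n (∑ i ∈ t, Finsupp.single i 1) = fun i => if i ∈ t then (1 : ℤ) else 0 := by
  funext j
  rw [SymmLaurent.expCast_apply, Finsupp.finsetSum_apply]
  simp only [Finsupp.single_apply]
  rw [Finset.sum_ite_eq']
  split_ifs <;> simp

/-- **The elementary symmetric polynomial `e_r` goes to `e_r(x) = ∑_{#t = r} x^{𝟙_t}`**, the Laurent polynomial occurring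
in `𝒮_R(T_r) = q^{-r(r-1)/2} e_r(x)` (`satakeTransformModP_doubleCosetOperator_heckeDiag`). [cite: CartierCorvallis1979, §IV.2 Example] -/
theorem mapDomainAlgHom_expCast_esymm (r : ℕ) :
    AddMonoidAlgebra.mapDomainAlgHom R R (SymmLaurent.expCast n) (MvPolynomial.esymm (Fin n) R r) =
      ∑ t ∈ Finset.powersetCard r (univ : Finset (Fin n)),
        AddMonoidAlgebra.single (fun i => if i ∈ t then (1 : ℤ) else 0) (1 : R) := by
  rw [MvPolynomial.esymm_eq_sum_monomial, map_sum]
  exact Finset.sum_congr rfl fun t _ => by rw [mapDomainAlgHom_expCast_monomial, expCast_sum_single_eq_indicator]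

/-- `e_r(x) ∈ R[ℤⁿ]^{S_n}`. [cite: CartierCorvallis1979, §IV.2 Example] -/
theorem sum_single_indicator_mem_weylInvariants (r : ℕ) :
    (∑ t ∈ Finset.powersetCard r (univ : Finset (Fin n)),
        AddMonoidAlgebra.single (fun i => if i ∈ t then (1 : ℤ) else 0) (1 : R)) ∈
      weylInvariants R (Fin n → ℤ) (ConnectedReductiveGroupData.glWeylGroup n) := by
  rw [← mapDomainAlgHom_expCast_esymm]
  exact mapDomainAlgHom_expCast_mem_weylInvariants (MvPolynomial.esymm_isSymmetric _ _ _)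

/-- A bound on the pole orders of a Laurent polynomial. [folklore] [cite: CartierCorvallis1979, §IV.2 Example] -/
theorem exists_neg_natCast_le_of_mem_support (f : AddMonoidAlgebra R (Fin n → ℤ)) :
    ∃ k : ℕ, ∀ x ∈ f.coeff.support, ∀ i, -(k : ℤ) ≤ x i := by
  refine ⟨f.coeff.support.sup fun x => Finset.univ.sup fun i => (x i).natAbs, ?_⟩
  intro x hx i
  have h1 : (x i).natAbs ≤ Finset.univ.sup fun j => (x j).natAbs :=
    Finset.le_sup (f := fun j => (x j).natAbs) (Finset.mem_univ i)
  have h2 : (Finset.univ.sup fun j => (x j).natAbs) ≤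
      f.coeff.support.sup fun y => Finset.univ.sup fun j => (y j).natAbs :=
    Finset.le_sup (f := fun y => Finset.univ.sup fun j => (y j).natAbs) hx
  have h3 : ((x i).natAbs : ℤ) ≤
      ((f.coeff.support.sup fun y => Finset.univ.sup fun j => (y j).natAbs : ℕ) : ℤ) := by
    exact_mod_cast h1.trans h2
  omega

/-- Clearing denominators: if all exponents of `f` are `≥ -k`, those of `[k𝟙] · f` are `≥ 0`. [folklore]
[cite: CartierCorvallis1979, §IV.2 Example] -/
theorem forall_nonneg_of_mem_support_single_mul {f : AddMonoidAlgebra R (Fin n → ℤ)} {k : ℕ}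
    (hk : ∀ x ∈ f.coeff.support, ∀ i, -(k : ℤ) ≤ x i) :
    ∀ y ∈ (AddMonoidAlgebra.single (fun _ : Fin n => (k : ℤ)) (1 : R) * f).coeff.support, 0 ≤ y := by
  classical
  intro y hy
  obtain ⟨x, hx, rfl⟩ := Finset.mem_image.1 (AddMonoidAlgebra.support_coeff_single_mul_subset f 1 _ hy)
  intro i
  have := hk x hx i
  simp only [Pi.add_apply, Pi.zero_apply]
  omega

end Laurent

/-! ## §2 The transform on the generators `c_{(1^{r+1})}`, `T_{ϖ 1_n}`, `T_{ϖ⁻¹ 1_n}` -/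

section Generators

variable {F : Type*} [Field F] [ValuativeRel F] {n : ℕ} [IsDiscreteValuationRing 𝒪[F]] [Finite 𝓀[F]] {ϖ : F}
  (hϖ : IsUniformizingElement ϖ) {R : Type*} [CommRing R] (hq : IsUnit ((Nat.card 𝓀[F] : ℕ) : R))
  [IsHeckeTriple (⊤ : Submonoid (GL (Fin n) F)) (glInt n F) (glInt n F)]

/-- `𝒮_R(c_{(1^{r+1})}) = q^{-(r+1)r/2} e_{r+1}(x)` for the generator `c_{(1^{r+1})} = T_{r+1}` (`r : Fin n`).
[cite: ShimuraIATAF1971, Thm. 3.21] [cite: CartierCorvallis1979, §IV.2 Example] -/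
theorem satakeTransformModP_doubleCosetOperator_zpowDiagGL_indicator_le (r : Fin n) :
    satakeTransformModP hϖ hq (heckeAlgebra.doubleCosetOperator (glInt n F)
        (zpowDiagGL hϖ.ne_zero fun i : Fin n => if (i : ℕ) ≤ (r : ℕ) then (1 : ℤ) else 0)) =
      ((hq.unit⁻¹ ^ (((r : ℕ) + 1) * ((r : ℕ) + 1 - 1) / 2) : Rˣ) : R) •
        ∑ t ∈ Finset.powersetCard ((r : ℕ) + 1) (univ : Finset (Fin n)),
          AddMonoidAlgebra.single (fun i => if i ∈ t then (1 : ℤ) else 0) (1 : R) := by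
  rw [zpowDiagGL_indicator_le_eq_heckeDiag, satakeTransformModP_doubleCosetOperator_heckeDiag hϖ hq (Nat.succ_le_of_lt r.isLt)]

/-- `𝒮_R(T_{ϖ 1_n}) = q^{-n(n-1)/2} x^{𝟙}` (`e_n(x) = x_1 ⋯ x_n`). [cite: ShimuraIATAF1971, Thm. 3.21] [cite: Macdonald1995, Ch. V (2.5)] -/
theorem satakeTransformModP_doubleCosetOperator_zpowDiagGL_one :
    satakeTransformModP hϖ hq (heckeAlgebra.doubleCosetOperator (glInt n F) (zpowDiagGL hϖ.ne_zero fun _ : Fin n => (1 : ℤ))) =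
      AddMonoidAlgebra.single (fun _ : Fin n => (1 : ℤ)) ((hq.unit⁻¹ ^ (n * (n - 1) / 2) : Rˣ) : R) := by
  rw [← heckeDiag_mk0_self_eq_zpowDiagGL_one, satakeTransformModP_doubleCosetOperator_heckeDiag hϖ hq le_rfl]
  have h : Finset.powersetCard n (univ : Finset (Fin n)) = {univ} := by
    simpa using Finset.powersetCard_self (univ : Finset (Fin n))
  rw [h, Finset.sum_singleton, AddMonoidAlgebra.smul_single, smul_eq_mul, mul_one]
  congr 1
  funext i
  exact if_pos (Finset.mem_univ i)

/-- `𝒮_R(T_{ϖ⁻¹ 1_n}) = q^{n(n-1)/2} x^{-𝟙}` (the inverse of `𝒮_R(T_{ϖ 1_n})`, as `T_{ϖ⁻¹ 1_n} T_{ϖ 1_n} = 1`).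
[cite: Macdonald1995, Ch. V (2.5)] -/
theorem satakeTransformModP_doubleCosetOperator_zpowDiagGL_neg_one :
    satakeTransformModP hϖ hq (heckeAlgebra.doubleCosetOperator (glInt n F) (zpowDiagGL hϖ.ne_zero fun _ : Fin n => (-1 : ℤ))) =
      AddMonoidAlgebra.single (fun _ : Fin n => (-1 : ℤ)) ((hq.unit ^ (n * (n - 1) / 2) : Rˣ) : R) := by
  have h1 : satakeTransformModP hϖ hq (heckeAlgebra.doubleCosetOperator (glInt n F) (zpowDiagGL hϖ.ne_zero fun _ : Fin n => (-1 : ℤ))) *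
      satakeTransformModP hϖ hq (heckeAlgebra.doubleCosetOperator (glInt n F) (zpowDiagGL hϖ.ne_zero fun _ : Fin n => (1 : ℤ))) = 1 := by
    rw [← map_mul, doubleCosetOperator_zpowDiagGL_neg_one_mul_one_of_commRing hϖ, map_one]
  have h2 : satakeTransformModP hϖ hq (heckeAlgebra.doubleCosetOperator (glInt n F) (zpowDiagGL hϖ.ne_zero fun _ : Fin n => (1 : ℤ))) *
      AddMonoidAlgebra.single (fun _ : Fin n => (-1 : ℤ)) ((hq.unit ^ (n * (n - 1) / 2) : Rˣ) : R) = 1 := by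
    have h0 : ((fun _ : Fin n => (1 : ℤ)) + fun _ : Fin n => (-1 : ℤ)) = 0 := funext fun _ => by simp
    have hu : ((hq.unit⁻¹ ^ (n * (n - 1) / 2) : Rˣ) : R) * ((hq.unit ^ (n * (n - 1) / 2) : Rˣ) : R) = 1 := by
      rw [← Units.val_mul, inv_pow, inv_mul_cancel, Units.val_one]
    rw [satakeTransformModP_doubleCosetOperator_zpowDiagGL_one, AddMonoidAlgebra.single_mul_single, h0, hu,
      AddMonoidAlgebra.one_def]
  exact left_inv_eq_right_inv h1 h2

end Generators

/-! ## §3 The image of `𝒮_R` is `R[ℤⁿ]^{S_n}`: the Satake isomorphism over `R` -/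

section Isomorphism

variable {F : Type*} [Field F] [ValuativeRel F] {n : ℕ} [IsDiscreteValuationRing 𝒪[F]] [Finite 𝓀[F]] {ϖ : F}
  (hϖ : IsUniformizingElement ϖ) {R : Type*} [CommRing R] (hq : IsUnit ((Nat.card 𝓀[F] : ℕ) : R))
  [IsHeckeTriple (⊤ : Submonoid (GL (Fin n) F)) (glInt n F) (glInt n F)]

/-- **The Satake transform takes values in the `S_n`-invariants `R[ℤⁿ]^{S_n}`**: `ℋ_R` is generated by the `c_{(1^r)}` and
`T_{ϖ⁻¹ 1_n}` (g42-#3), whose transforms `q^{-r(r-1)/2} e_r(x)` and `q^{n(n-1)/2} x^{-𝟙}` are invariant.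
[cite: CartierCorvallis1979, §IV Thm. 4.1] [cite: TreumannVenkatesh2016, §7.2 Theorem (i)] -/
theorem satakeTransformModP_mem_weylInvariants (T : heckeAlgebra R (GL (Fin n) F) (glInt n F)) :
    satakeTransformModP hϖ hq T ∈ weylInvariants R (Fin n → ℤ) (ConnectedReductiveGroupData.glWeylGroup n) := by
  have h : (satakeTransformModP hϖ hq).range ≤ weylInvariants R (Fin n → ℤ) (ConnectedReductiveGroupData.glWeylGroup n) := by
    rw [← Algebra.map_top, ← adjoin_glInt_zpowDiagGL_insert_eq_top_of_commRing (R := R) hϖ, AlgHom.map_adjoin,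
      Algebra.adjoin_le_iff]
    rintro _ ⟨x, hx, rfl⟩
    rcases hx with rfl | ⟨r, rfl⟩
    · rw [satakeTransformModP_doubleCosetOperator_zpowDiagGL_neg_one]
      exact single_const_mem_weylInvariants_glWeylGroup (-1) _
    · rw [satakeTransformModP_doubleCosetOperator_zpowDiagGL_indicator_le]
      exact Subalgebra.smul_mem _ (sum_single_indicator_mem_weylInvariants _) _
  exact h ⟨T, rfl⟩

/-- **Every `S_n`-invariant Laurent polynomial over `R` is a Satake transform** (`q ∈ Rˣ`): for `f ∈ R[ℤⁿ]^{S_n}` and `k`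
beyond its pole orders, `x^{k𝟙} f` is the image of a symmetric polynomial `p = P(e_1, …, e_n)` (fundamental theorem of
symmetric polynomials over `R`), each `e_r(x) = q^{r(r-1)/2} 𝒮_R(T_r)` and `x^{-𝟙} = q^{-n(n-1)/2} 𝒮_R(T_{ϖ⁻¹ 1_n})` is a
transform, hence so is `f = (x^{-𝟙})^k · P(e_1(x), …, e_n(x))`. [cite: CartierCorvallis1979, §IV Thm. 4.1, §IV.2 Example]
[cite: TreumannVenkatesh2016, §7.2 Theorem (i)] [cite: GrossSatake1998, §3] -/
theorem mem_range_satakeTransformModP_of_mem_weylInvariants {f : AddMonoidAlgebra R (Fin n → ℤ)}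
    (hf : f ∈ weylInvariants R (Fin n → ℤ) (ConnectedReductiveGroupData.glWeylGroup n)) :
    f ∈ (satakeTransformModP hϖ hq).range := by
  classical
  obtain ⟨k, hk⟩ := exists_neg_natCast_le_of_mem_support f
  obtain ⟨p, hp⟩ := exists_mapDomainAlgHom_expCast_eq (forall_nonneg_of_mem_support_single_mul hk)
  -- `p` is symmetric, hence a polynomial in the `e_r`
  have hps : p.IsSymmetric := isSymmetric_of_mapDomainAlgHom_expCast_mem_weylInvariants
    (by rw [hp]; exact mul_mem (single_const_mem_weylInvariants_glWeylGroup (k : ℤ) 1) hf)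
  obtain ⟨P, hP⟩ := (MvPolynomial.esymmAlgHom_fin_bijective R n).2 ⟨p, hps⟩
  have hPval : MvPolynomial.aeval (fun i : Fin n => MvPolynomial.esymm (Fin n) R (i + 1)) P = p := by
    rw [← MvPolynomial.esymmAlgHom_apply, hP]
  -- the `e_r(x)` are transforms
  have he : ∀ i : Fin n, AddMonoidAlgebra.mapDomainAlgHom R R (SymmLaurent.expCast n) (MvPolynomial.esymm (Fin n) R (i + 1)) ∈
      (satakeTransformModP hϖ hq).range := fun i => by
    rw [mapDomainAlgHom_expCast_esymm]
    have hsum : (∑ t ∈ Finset.powersetCard ((i : ℕ) + 1) (univ : Finset (Fin n)),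
          AddMonoidAlgebra.single (fun j => if j ∈ t then (1 : ℤ) else 0) (1 : R)) =
        ((hq.unit ^ (((i : ℕ) + 1) * ((i : ℕ) + 1 - 1) / 2) : Rˣ) : R) •
          satakeTransformModP hϖ hq (heckeAlgebra.doubleCosetOperator (glInt n F)
            (zpowDiagGL hϖ.ne_zero fun j : Fin n => if (j : ℕ) ≤ (i : ℕ) then (1 : ℤ) else 0)) := by
      rw [satakeTransformModP_doubleCosetOperator_zpowDiagGL_indicator_le, smul_smul, ← Units.val_mul, inv_pow,
        mul_inv_cancel, Units.val_one, one_smul]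
    rw [hsum]
    exact Subalgebra.smul_mem _ ((satakeTransformModP hϖ hq).mem_range.2 ⟨_, rfl⟩) _
  have hιp : AddMonoidAlgebra.mapDomainAlgHom R R (SymmLaurent.expCast n) p ∈ (satakeTransformModP hϖ hq).range := by
    rw [← hPval, ← AlgHom.comp_apply, MvPolynomial.comp_aeval]
    have hle : (MvPolynomial.aeval fun i : Fin n =>
        AddMonoidAlgebra.mapDomainAlgHom R R (SymmLaurent.expCast n) (MvPolynomial.esymm (Fin n) R (i + 1))).range ≤
        (satakeTransformModP hϖ hq).range := by
      rw [MvPolynomial.aeval_range, Algebra.adjoin_le_iff]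
      rintro _ ⟨i, rfl⟩
      exact he i
    exact hle ⟨P, rfl⟩
  -- `x^{-𝟙}` is a transform
  have hneg : AddMonoidAlgebra.single (fun _ : Fin n => (-1 : ℤ)) (1 : R) ∈ (satakeTransformModP hϖ hq).range := by
    have h' : AddMonoidAlgebra.single (fun _ : Fin n => (-1 : ℤ)) (1 : R) = ((hq.unit⁻¹ ^ (n * (n - 1) / 2) : Rˣ) : R) •
        satakeTransformModP hϖ hq (heckeAlgebra.doubleCosetOperator (glInt n F) (zpowDiagGL hϖ.ne_zero fun _ : Fin n => (-1 : ℤ))) := by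
      rw [satakeTransformModP_doubleCosetOperator_zpowDiagGL_neg_one, AddMonoidAlgebra.smul_single, smul_eq_mul, ← Units.val_mul,
        inv_pow, inv_mul_cancel, Units.val_one]
    rw [h']
    exact Subalgebra.smul_mem _ ((satakeTransformModP hϖ hq).mem_range.2 ⟨_, rfl⟩) _
  -- `f = (x^{-𝟙})^k · (x^{k𝟙} f)`
  have hf' : f = AddMonoidAlgebra.single (fun _ : Fin n => (-1 : ℤ)) (1 : R) ^ k *
      (AddMonoidAlgebra.single (fun _ : Fin n => (k : ℤ)) (1 : R) * f) := by
    rw [← mul_assoc, AddMonoidAlgebra.single_pow, one_pow, AddMonoidAlgebra.single_mul_single, one_mul]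
    have h0 : k • (fun _ : Fin n => (-1 : ℤ)) + (fun _ : Fin n => (k : ℤ)) = 0 := funext fun i => by simp
    rw [h0, ← AddMonoidAlgebra.one_def, one_mul]
  rw [hf', ← hp]
  exact mul_mem (pow_mem hneg k) hιp

/-- **The image of `𝒮_R` is exactly `R[ℤⁿ]^{S_n}`.** [cite: CartierCorvallis1979, §IV Thm. 4.1] [cite: TreumannVenkatesh2016, §7.2 Theorem (i)] -/
theorem range_satakeTransformModP_eq_weylInvariants :
    (satakeTransformModP hϖ hq).range = weylInvariants R (Fin n → ℤ) (ConnectedReductiveGroupData.glWeylGroup n) :=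
  le_antisymm (by rintro _ ⟨T, rfl⟩; exact satakeTransformModP_mem_weylInvariants hϖ hq T)
    fun _ hf => mem_range_satakeTransformModP_of_mem_weylInvariants hϖ hq hf

/-- **THE SATAKE ISOMORPHISM WITH COEFFICIENTS IN ANY COMMUTATIVE RING `R` WITH `q ∈ Rˣ`** (every non-archimedean `F` whose
valuation ring is a DVR with finite residue field): `𝒮_R` is a bijection of `ℋ_R(GL_n(F), GL_n(𝒪))` onto
`R[ℤⁿ]^{S_n} = weylInvariants R (Fin n → ℤ) (glWeylGroup n)` — verbatim the statement recorded as not proved in the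
module docstring of `SatakeTransformModP`.  For `R = ℂ` this is the tree's `SatakeParametersGL.satake_gl_holds`
(`SatakeParametersGLIsoProofs`, local fields of characteristic `0`); here any `R`, any `F`.
[cite: TreumannVenkatesh2016, §7.2 Theorem (i)] [cite: CartierCorvallis1979, §IV Thm. 4.1] [cite: GrossSatake1998, §3] -/
theorem bijective_codRestrict_satakeTransformModP :
    Function.Bijective ((satakeTransformModP hϖ hq).codRestrict
      (weylInvariants R (Fin n → ℤ) (ConnectedReductiveGroupData.glWeylGroup n)) (satakeTransformModP_mem_weylInvariants hϖ hq)) := by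
  refine ⟨fun S T h => satakeTransformModP_injective hϖ hq (congrArg Subtype.val h), fun f => ?_⟩
  obtain ⟨T, hT⟩ := mem_range_satakeTransformModP_of_mem_weylInvariants hϖ hq f.2
  exact ⟨T, Subtype.ext hT⟩

/-- **`ℋ_R(GL_n(F), GL_n(𝒪)) ≃ₐ[R] R[ℤⁿ]^{S_n}`** through `𝒮_R` (`q ∈ Rˣ`). [cite: TreumannVenkatesh2016, §7.2 Theorem (i)]
[cite: CartierCorvallis1979, §IV Thm. 4.1] -/
theorem exists_algEquiv_satakeTransformModP_weylInvariants :
    ∃ e : heckeAlgebra R (GL (Fin n) F) (glInt n F) ≃ₐ[R]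
        weylInvariants R (Fin n → ℤ) (ConnectedReductiveGroupData.glWeylGroup n),
      ∀ T, (e T : AddMonoidAlgebra R (Fin n → ℤ)) = satakeTransformModP hϖ hq T :=
  ⟨AlgEquiv.ofBijective _ (bijective_codRestrict_satakeTransformModP hϖ hq), fun _ => rfl⟩

end Isomorphism

end Literature.NumberTheory.Automorphic

end
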